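import Summits.BirchSwinnertonDyer.BirchSwinnertonDyer.Theorems.ThetaPartnerAtTwoSignedKatoUpToAtTwoInvolChain
import HarnessLib

/-!
# Route `ThetaPartnerAtTwo` (TP2), crux K3 `SignedKatoDivisibilityUpToAtTwo` (item stmt-BirchSwinnertonDyer-20308),
# line `colemanrat` v16: THE GZK SOCKET — Gross–Zagier–Kolyvagin enters the K3 chain ONLY as the rank statement
# (RK) `rank_Λ 𝐇¹_Γ(T₂E) ≤ 1` on the habitat; the registered stub (CHAIN^ι) `stub_involChainTwo` re-run with (RK) in
# place of GZK, and the three published suppliers of (RK): GZK, `Sel_{2^∞}(E/ℚ)` finite, Kato Thm. 12.4 (2)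

Width seat `bsd-wall-tp2-p2x-w3` g10 (cell `bsd-wall`). HONEST FRAMING: THEOREMS ONLY — no definition, no named fact, no
instance, no `sorry`; every K3-level statement here is an IMPLICATION displaying its antecedents; nothing is closed;
K3 / K3P′ are NOT settled; BSD is NOT proved by any of this.

## Why this file

In v16 the crux reads K3 ⟸ {`Kato2004.thm13_4_two_lengthAt_fineSelmerDualContra_le_of_isEulerSystemClassTwo`,
`rank_eq_analyticRank_of_analyticRank_le_one` (GZK), `Kato2004.exists_eulerSystem_expStar_tatePairing_values_two`} BY NAME
(`KatoBK.signedKatoDivisibilityUpToAtTwo_of_kato_facts_of_gzk`, file `…OfPubKatoFact`). Reading the chain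
(`…_of_corePairChiPrim → …_of_core → …_of_ptOrth_of_core → …_of_layerSide → …_of_h1Side → …_of_packageInv →
stub_involChainTwo`), the hypothesis `hGZK` is handed down untouched and CONSUMED at exactly two places of
`SignedKatoOffTwo.stub_involChainTwo` (file `…InvolChain`): `injective_col_of_gzk'` (injectivity of the localisation
`col : 𝐇¹ → P` from `rank_Λ 𝐇¹ ≤ 1`, torsion-freeness and `ι_P (col s) ≠ 0`, Kato (17.13.2)) and
`lengthAt_quotient_span_ne_top_of_gzk` (`ℓ_𝔮(𝐇¹/Λs) < ⊤` from `rank_Λ 𝐇¹ ≤ 1`). Both use GZK only through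
(R0) ⇒ `rank_{ℤ₂} H¹(ℤ[1/2], T₂E) ≤ 1` ⇒ `IwasawaH1Data.rank_le_one_of_rank_integralH1_le_one`. So the exact arithmetic
input is (RK), and this file makes that a SOCKET:

* §1 `injective_col_of_rank_le_one`, `lengthAt_quotient_span_ne_top_of_rank_le_one` — the two consumers with the
  hypothesis `Module.rank Λ I.H ≤ 1` in place of GZK (any prime `p`, any `W`; tree theorems `isTorsionFree`,
  `module_finite_of_isCyclotomic`, `noZeroSMulDivisors`, `Module.injective_of_rank_le_one`,
  `MemberHullRankOne.isTorsion_quotient_span_singleton_of_rank_le_one`, `lengthAt_ne_top_of_isTorsionBy`).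
* §2 the three PUBLISHED suppliers of (RK), each for every prime `p`: `rank_iwasawaH1_le_one_of_gzk` (GZK in analytic
  rank `0`: `W(ℚ)`, `Ш` finite ⇒ (R0) `IntegralH1RankZero.rank_integralH1_layerZero_le_one`),
  `rank_iwasawaH1_le_one_of_finite_selmerGroupPInfty` (`Sel_{p^∞}(E/ℚ)` finite — the input GZK actually supplies, and
  the conclusion of Kato Cor. 14.3 (1) / Thm. 14.2 at `L(E,1) ≠ 0`), `rank_iwasawaH1_le_one_of_thm12_4` (the EXISTING
  named fact `Kato2004.thm12_4`, Kato Thm. 12.4 (2): `𝐇¹` torsion free of `Λ`-rank `1`, every `p`).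
* §3 `stub_involChainTwo_of_rankLeOne` — the registered stub (CHAIN^ι) VERBATIM except that its second antecedent
  `rank_eq_analyticRank_of_analyticRank_le_one` is replaced by the habitat rank statement
  (RK) `∀ habitat W κ γ I, Module.rank (IwasawaAlgebra 2) I.H ≤ 1`; proof = the landed proof of `stub_involChainTwo`
  (w2 g3) with the two §1 lemmas; feeding (RK) by `rank_iwasawaH1_le_one_of_gzk` recovers the registered stub.
The K3-level certificates over the socket (K3 ⟸ {13.4 (2)@2, (RK), fact}; the Kato-2004-only reading
K3 ⟸ {Kato 13.4 (2)@2, Kato 12.4, Kato 12.5-package}) are the sibling file `…OfPubKatoOnly`.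

References: [Kato2004Asterisque] Thm. 12.4 (2) (p. 221), Thm. 13.4 (2) (p. 226), Thm. 14.2 / Cor. 14.3 (p. 235),
Thm. 14.5 (1) (p. 236), §17.13 (17.13.2) (p. 279); [Kobayashi2003] (7.17)–(7.21), Thm. 7.3; [Darmon2004] Thm. 3.22;
[GreenbergLNM1716] §1 p. 60.
-/

set_option autoImplicit false
-- the Theorems namespace of this sub repeats the summit name by design (D-0017 nested layout)
set_option linter.dupNamespace false

noncomputable section

open scoped Classical MatrixGroups ModularForm NumberField

open CongruenceSubgroup WeierstrassCurve Field IsDedekindDomain NumberField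
  Literature.NumberTheory.GaloisRepresentations
  Literature.NumberTheory.EllipticCurves Literature.NumberTheory.EllipticCurves.ModularForms
  Literature.NumberTheory.EllipticCurves.Module Literature.NumberTheory.EllipticCurves.Rank1Residual
  Literature.NumberTheory.EllipticCurves.Kobayashi2003 Literature.NumberTheory.EllipticCurves.Kato2004
  Literature.NumberTheory.EllipticCurves.Kato2004.EulerSystemValues Literature.NumberTheory.EllipticCurves.GreenbergSelmer
  ZpExtension Summit.BirchSwinnertonDyer.Rank1Residual.Supersingular
  Summit.BirchSwinnertonDyer.BirchSwinnertonDyer.Theses.ThetaPartnerAtTwo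

namespace Summit.BirchSwinnertonDyer.BirchSwinnertonDyer.Theorems

namespace SignedKatoOffTwo

/-! ## §1 The two GZK-consumers of the chain, with `rank_Λ 𝐇¹ ≤ 1` as the hypothesis -/

section RankSocket

variable {W : WeierstrassCurve ℚ} [W.IsElliptic] {p : ℕ} [Fact p.Prime]
  [ContinuousSMul ℤ_[p] (W.tateModule p)] {κ : ZpExtension ℚ p} {γ : Field.absoluteGaloisGroup ℚ}

/-- **Injectivity of a Coleman-type map from `rank_Λ 𝐇¹ ≤ 1`** (Kato (17.13.2)): for a pinned
`I : IwasawaH1Data W p κ γ` with `Module.rank Λ I.H ≤ 1`, `Λ`-linear `col : 𝐇¹ → P`, `ι : P → Λ` and a class `s` with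
`ι (col s) ≠ 0`, the map `col` is injective — `𝐇¹` is torsion free (`IwasawaH1Data.isTorsionFree`), `Λ` is a domain.
This is `injective_col_of_gzk'` with its GZK hypothesis replaced by the rank statement it was used for.
[cite: Kato2004Asterisque, §17.13 (17.13.2) (p. 279), Thm. 12.4 (2) (p. 221)] -/
theorem injective_col_of_rank_le_one (hγ : κ.IsTopGenerator γ) (I : Kato2004.IwasawaH1Data W p κ γ)
    (hrank : Module.rank (IwasawaAlgebra p) I.H ≤ 1)
    {P : Type*} [AddCommGroup P] [_root_.Module (IwasawaAlgebra p) P]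
    (ι : P →ₗ[IwasawaAlgebra p] IwasawaAlgebra p) (col : I.H →ₗ[IwasawaAlgebra p] P) {s : I.H}
    (hcs : ι (col s) ≠ 0) : Function.Injective col := by
  haveI : Module.IsTorsionFree (IwasawaAlgebra p) I.H := I.isTorsionFree hγ
  refine injective_of_rank_le_one hrank col s fun a ha ↦ ?_
  have ha' : a * ι (col s) = 0 := by rw [← smul_eq_mul, ← map_smul, ha, map_zero]
  exact (mul_eq_zero.mp ha').resolve_right hcs

/-- **`ℓ_𝔭(𝐇¹_Γ(T_pW)/Λs) < ⊤` for non-zero `s`, from `rank_Λ 𝐇¹ ≤ 1`.** For a pinned `I : IwasawaH1Data W p κ γ`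
(`κ` cyclotomic, `γ` a topological generator) with `Module.rank Λ I.H ≤ 1`, `s ≠ 0` and a prime `𝔭` of `Λ` of height
`≤ 1`: `ℓ_𝔭(𝐇¹/Λs) ≠ ⊤` — `𝐇¹` is finitely generated ((12.2.1), `module_finite_of_isCyclotomic`) and torsion free
(`noZeroSMulDivisors`), so `𝐇¹/Λs` is finitely generated torsion (`MemberHullRankOne.isTorsion_quotient_span_singleton_of_rank_le_one`)
and has finite local length at height `≤ 1` (`lengthAt_ne_top_of_isTorsionBy`). This is
`lengthAt_quotient_span_ne_top_of_gzk` with its GZK hypothesis replaced by the rank statement it was used for.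
[cite: Kato2004Asterisque, §12.2 (12.2.1) (p. 220), Thm. 12.4 (2) (p. 221)] -/
theorem lengthAt_quotient_span_ne_top_of_rank_le_one (hκ : κ.IsCyclotomic) (hγ : κ.IsTopGenerator γ)
    (I : Kato2004.IwasawaH1Data W p κ γ) (hrank : Module.rank (IwasawaAlgebra p) I.H ≤ 1) {s : I.H} (hs : s ≠ 0)
    (𝔭 : PrimeSpectrum (IwasawaAlgebra p)) (h𝔭 : 𝔭.asIdeal.height ≤ 1) :
    lengthAt (IwasawaAlgebra p) (I.H ⧸ Submodule.span (IwasawaAlgebra p) {s}) 𝔭 ≠ ⊤ := by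
  haveI : Module.Finite (IwasawaAlgebra p) I.H := Kato2004.IwasawaH1Data.module_finite_of_isCyclotomic hκ hγ I
  haveI : NoZeroSMulDivisors (IwasawaAlgebra p) I.H := I.noZeroSMulDivisors hγ
  have htors : Module.IsTorsion (IwasawaAlgebra p) (I.H ⧸ Submodule.span (IwasawaAlgebra p) {s}) :=
    MemberHullRankOne.isTorsion_quotient_span_singleton_of_rank_le_one p hrank hs
  obtain ⟨a, ha, ha0⟩ := Submodule.annihilator_top_inter_nonZeroDivisors htors
  exact lengthAt_ne_top_of_isTorsionBy (nonZeroDivisors.ne_zero ha0)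
    (fun m ↦ Submodule.mem_annihilator.mp ha m Submodule.mem_top) 𝔭 h𝔭

/-! ## §2 The three published suppliers of (RK) `rank_Λ 𝐇¹_Γ(T_pW) ≤ 1` -/

/-- **(RK) ⟸ `Sel_{p^∞}(E/ℚ)` finite** — the input Gross–Zagier–Kolyvagin actually supplies, and the conclusion of
Kato's own Thm. 14.2 / Cor. 14.3 (1) at `L(E, 1) ≠ 0`: (R0) `rank_{ℤ_p} H¹(ℤ[1/p], T_pW) ≤ 1`
(`IntegralH1RankZero.rank_integralH1_layerZero_le_one_of_finite_selmerGroupPInfty`, Kato Thm. 14.5 (1)/14.13, Euler-system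
free) and Kato Thm. 12.4 (2) upper half on the pin (`IwasawaH1Data.rank_le_one_of_rank_integralH1_le_one`). Every `W`, every `p`.
[cite: Kato2004Asterisque, Thm. 12.4 (2) (p. 221), Cor. 14.3 (1) (p. 235), Thm. 14.5 (1) (p. 236), 14.13 (p. 243)] -/
theorem rank_iwasawaH1_le_one_of_finite_selmerGroupPInfty [Finite (W.selmerGroupPInfty p)]
    (hκ : κ.IsCyclotomic) (hγ : κ.IsTopGenerator γ) (I : Kato2004.IwasawaH1Data W p κ γ) :
    Module.rank (IwasawaAlgebra p) I.H ≤ 1 :=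
  I.rank_le_one_of_rank_integralH1_le_one hκ hγ
    (IntegralH1RankZero.rank_integralH1_layerZero_le_one_of_finite_selmerGroupPInfty W p κ)

/-- **(RK) ⟸ Gross–Zagier–Kolyvagin, in analytic rank `0`**: `h17` gives `W(ℚ)` and `Ш(W)` finite, hence (R0)
`rank_{ℤ_p} H¹(ℤ[1/p], T_pW) ≤ 1` (`IntegralH1RankZero.rank_integralH1_layerZero_le_one`) and `rank_Λ 𝐇¹ ≤ 1`
(`IwasawaH1Data.rank_le_one_of_rank_integralH1_le_one`). Every `p`. Exactly the opening lines of `injective_col_of_gzk` /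
`lengthAt_quotient_span_ne_top_of_gzk`. [cite: Kato2004Asterisque, Thm. 12.4 (2) (p. 221), Thm. 14.5 (1) (p. 236)] [cite: Darmon2004, Thm. 3.22] -/
theorem rank_iwasawaH1_le_one_of_gzk (h17 : rank_eq_analyticRank_of_analyticRank_le_one)
    (hr : W.analyticRank = 0) (hκ : κ.IsCyclotomic) (hγ : κ.IsTopGenerator γ) (I : Kato2004.IwasawaH1Data W p κ γ) :
    Module.rank (IwasawaAlgebra p) I.H ≤ 1 := by
  obtain ⟨hrank, hsha⟩ := h17 W (by rw [hr]; exact zero_le_one)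
  have h0 : W.mordellWeilRank = 0 := by rw [hrank, hr]
  haveI : Finite W.toAffine.Point := W.finite_point_of_rank_zero h0
  haveI : Finite W.sha := hsha
  haveI : Finite (AddCommGroup.primaryComponent W.sha p) := inferInstance
  exact I.rank_le_one_of_rank_integralH1_le_one hκ hγ (IntegralH1RankZero.rank_integralH1_layerZero_le_one W p κ)

/-- **(RK) ⟸ Kato Thm. 12.4 (2)** (the EXISTING named Literature fact `Kato2004.thm12_4`: `𝐇¹_Γ(T_pW)` is torsion free of
`Λ`-rank `1`, every `W`, every `p`): its consumer shape `thm12_4.isTorsionFree_and_rank_le_one`. CONDITIONAL on that fact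
(unproved in the tree: Kato §13, the Euler-system argument). [cite: Kato2004Asterisque, Thm. 12.4 (2) (p. 221)] -/
theorem rank_iwasawaH1_le_one_of_thm12_4 (h124 : Kato2004.thm12_4) (hκ : κ.IsCyclotomic) (hγ : κ.IsTopGenerator γ)
    (I : Kato2004.IwasawaH1Data W p κ γ) : Module.rank (IwasawaAlgebra p) I.H ≤ 1 :=
  (h124.isTorsionFree_and_rank_le_one W p hκ hγ I).2

end RankSocket

/-! ## §3 The registered stub (CHAIN^ι) with the GZK antecedent replaced by the habitat rank statement (RK) -/

section Chain

/-- **(CHAIN^ι) of line `colemanrat`, GZK-SOCKET FORM: (K2^ι) → (RK) → (R2^ι) → K3's local form off `2`.** VERBATIM the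
registered stub `stub_involChainTwo` (w2 g3, file `…InvolChain`) except for its SECOND antecedent: Gross–Zagier–Kolyvagin
`rank_eq_analyticRank_of_analyticRank_le_one` is replaced by (RK) «for every habitat curve `W` (non-CM, `r_an = 0`, good
supersingular at `2` with `a₂ = 0`, globally minimal), the cyclotomic `κ`, `γ`, and every pinned `I : IwasawaH1Data W 2 κ γ`:
`rank_Λ 𝐇¹_Γ(T₂W) ≤ 1`» — the only thing the chain ever extracts from GZK. Road = the landed proof of `stub_involChainTwo`
with `injective_col_of_rank_le_one` / `lengthAt_quotient_span_ne_top_of_rank_le_one` (§1) in place of `injective_col_of_gzk'` /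
`lengthAt_quotient_span_ne_top_of_gzk`: the place `v₂`, the package at `𝔮 = ι𝔭` (`IwasawaInvolution.height_comap_invol`,
`C_mem_comap_invol_iff`), `L♭ ≠ 0 ⇒ ι_P col s ≠ 0 ⇒ s ≠ 0`, the canonical fine dual and `k : X⁺ ↠ X₀`
(`FineRestriction.exists_fineRestrict_package`), the cover of `ker k` with exponent `m + 1`
(`FineSandwich.toDual_two_nsmul_apply_eq_zero`, `FineStrictRat.localCover_of_localCover_resOfLe_rat`), the semilinear four-term
inequality (`fourTerm_lengthAt_le_upTo_semilinear`), (K2^ι) at `𝔭`, the zeta bound at `𝔮`, the functional equation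
(`IwasawaInvolution.lengthAt_quotient_kobayashiL_comap_invol_eq`), cancellation of the finite `ℓ_𝔮(𝐇¹/Λs)`. Suppliers of (RK):
§2 (GZK; `Sel_{2^∞}` finite; `Kato2004.thm12_4`). [cite: Kobayashi2003, (7.17)–(7.21), Thm. 7.3 (pp. 12–13)]
[cite: Kato2004Asterisque, Thm. 12.4 (2) (p. 221), Thm. 13.4 (2) (p. 226), §17.13 (p. 279)] [cite: MazurTateTeitelbaum1986Invent, Ch. I §17]
[cite: GreenbergLNM1716, §1 p. 60] [cite: Sprung2017, Cor. 4.14] -/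
theorem stub_involChainTwo_of_rankLeOne :
    (∀ (W : WeierstrassCurve ℚ) [W.IsElliptic], ¬ W.HasCM →
      ∀ [ContinuousSMul ℤ_[2] (W.tateModule 2)] [Module.Free ℤ_[2] (W.tateModule 2)]
        [Module.Finite ℤ_[2] (W.tateModule 2)]
        (κ : ZpExtension ℚ 2) (γ : Field.absoluteGaloisGroup ℚ) (hκ : κ.IsCyclotomic), κ.IsTopGenerator γ →
      ∀ (I : Kato2004.IwasawaH1Data W 2 κ γ) (Y : W.FineSelmerDualData κ γ) (s : I.H),
        (∃ (S : Set (HeightOneSpectrum (𝓞 ℚ))) (_ : S.Finite)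
            (z : ∀ (k : ℕ) (r : (cyclotomicLevelsRat 2 S).Ideals),
              H1 (tateRep W 2) ((cyclotomicLevelsRat 2 S).level k r.1)),
            IsEulerSystem (cyclotomicLevelsRat 2 S) (tateRep W 2) 2 z ∧
            (∀ (k : ℕ) (r : (cyclotomicLevelsRat 2 S).Ideals),
              z k r ∈ integralH1 (tateRep W 2) 2 ((cyclotomicLevelsRat 2 S).level k r.1)) ∧
            ∀ n : ℕ, I.proj n s =
              Kato2004.levelToLayerTwo W hκ S n (z (n + 2) (cyclotomicLevelsRat 2 S).idealOne)) →
        s ≠ 0 →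
        ∀ 𝔭 : PrimeSpectrum (IwasawaAlgebra 2), 𝔭.asIdeal.height = 1 →
          PowerSeries.C (2 : ℤ_[2]) ∉ 𝔭.asIdeal →
          lengthAt (IwasawaAlgebra 2) Y.X 𝔭 ≤
            lengthAt (IwasawaAlgebra 2) (I.H ⧸ Submodule.span (IwasawaAlgebra 2) {s})
              (PrimeSpectrum.comap (IwasawaAlgebra.invol 2).toRingHom 𝔭)) →
    (∀ (W : WeierstrassCurve ℚ) [W.IsElliptic] [W.IsGloballyMinimal],
      ¬ W.HasCM → W.analyticRank = 0 → GoodSS W 2 → W.frobeniusTrace 2 = 0 →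
      ∀ [ContinuousSMul ℤ_[2] (W.tateModule 2)] (κ : ZpExtension ℚ 2) (γ : Field.absoluteGaloisGroup ℚ),
        κ.IsCyclotomic → κ.IsTopGenerator γ →
        ∀ I : Kato2004.IwasawaH1Data W 2 κ γ, Module.rank (IwasawaAlgebra 2) I.H ≤ 1) →
    (∀ (v : HeightOneSpectrum (𝓞 ℚ)), ((2 : ℕ) : 𝓞 ℚ) ∈ v.asIdeal →
    ∀ (W : WeierstrassCurve ℚ) [W.IsElliptic] [W.IsGloballyMinimal],
      ¬ W.HasCM → W.analyticRank = 0 → GoodSS W 2 → W.frobeniusTrace 2 = 0 →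
      ∀ (κ : ZpExtension ℚ 2) (γ : Field.absoluteGaloisGroup ℚ) (hκ : κ.IsCyclotomic),
        κ.IsTopGenerator γ → IsCyclotomicVariable 2 γ →
        ∀ [NeZero (W.conductorNorm ℤ)] (f : CuspForm (Gamma0 (W.conductorNorm ℤ)) 2),
          IsNewformOf W f → ∀ (ϖ : ℚ), (ϖ : ℝ) * W.realPeriodRat = plusPeriod f →
        ∀ (Lplus Lminus : IwasawaAlgebra 2), IsPollackPair f 2 Lplus Lminus →
        ∀ (D : SignedSelmerDualData W κ γ 1) [ContinuousSMul ℤ_[2] (W.tateModule 2)]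
          [Module.Free ℤ_[2] (W.tateModule 2)] [Module.Finite ℤ_[2] (W.tateModule 2)],
          Module.IsTorsion (IwasawaAlgebra 2) D.X →
          ∀ 𝔭 : PrimeSpectrum (IwasawaAlgebra 2), 𝔭.asIdeal.height = 1 →
            PowerSeries.C (2 : ℤ_[2]) ∉ 𝔭.asIdeal →
          ∃ (I : Kato2004.IwasawaH1Data W 2 κ γ)
            (P : Type) (_ : AddCommGroup P) (_ : _root_.Module (IwasawaAlgebra 2) P)
            (ι : P →ₗ[IwasawaAlgebra 2] IwasawaAlgebra 2) (col : I.H →ₗ[IwasawaAlgebra 2] P)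
            (j : P →+ D.X) (s : I.H) (m : ℕ),
            (∀ (g : IwasawaAlgebra 2) (y : P), j (g • y) = IwasawaAlgebra.invol 2 g • j y) ∧
            (∀ y, ι y = 0 → (PowerSeries.C (2 : ℤ_[2]) : IwasawaAlgebra 2) ^ m • y = 0) ∧
            (∀ x, (PowerSeries.C (2 : ℤ_[2]) : IwasawaAlgebra 2) ^ m • j (col x) = 0) ∧
            (∀ x : D.X,
              (∀ t : signedSelmerInfty W κ 1,
                resOfLe (W.geomPrimaryTorsion 2) (inf_le_left : κ.kerSubgroup ⊓ decomp v ≤ κ.kerSubgroup)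
                  (t : W.subgroupH1 2 κ.kerSubgroup) = 0 → D.toDual x t = 0) →
              ∃ y : P, j y = (PowerSeries.C (2 : ℤ_[2]) : IwasawaAlgebra 2) ^ m • x) ∧
            Kato2004.IsEulerSystemClassTwo W hκ I s ∧
            lengthAt (IwasawaAlgebra 2) (IwasawaAlgebra 2 ⧸ Ideal.span {ι (col s)}) 𝔭 ≤
              lengthAt (IwasawaAlgebra 2) (IwasawaAlgebra 2 ⧸ Ideal.span {kobayashiL 1 Lplus Lminus}) 𝔭) →
    (∀ (W : WeierstrassCurve ℚ) [W.IsElliptic] [W.IsGloballyMinimal],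
      ¬ W.HasCM → W.analyticRank = 0 → GoodSS W 2 → W.frobeniusTrace 2 = 0 →
      ∀ (κ : ZpExtension ℚ 2) (γ : Field.absoluteGaloisGroup ℚ),
        κ.IsCyclotomic → κ.IsTopGenerator γ → IsCyclotomicVariable 2 γ →
        ∀ [NeZero (W.conductorNorm ℤ)] (f : CuspForm (Gamma0 (W.conductorNorm ℤ)) 2),
          IsNewformOf W f → ∀ (ϖ : ℚ), (ϖ : ℝ) * W.realPeriodRat = plusPeriod f →
        ∀ (Lplus Lminus : IwasawaAlgebra 2), IsPollackPair f 2 Lplus Lminus →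
        ∀ (D : SignedSelmerDualData W κ γ 1), Module.IsTorsion (IwasawaAlgebra 2) D.X →
          ∀ 𝔭 : PrimeSpectrum (IwasawaAlgebra 2), 𝔭.asIdeal.height = 1 →
            PowerSeries.C (2 : ℤ_[2]) ∉ 𝔭.asIdeal →
            lengthAt (IwasawaAlgebra 2) D.X 𝔭 ≤
              lengthAt (IwasawaAlgebra 2) (IwasawaAlgebra 2 ⧸ Ideal.span {kobayashiL 1 Lplus Lminus}) 𝔭) := by
  intro hK2 hRK hR W _ _ hcm hr hss ha κ γ hκ hγ hcv _ f hf ϖ hϖ Lplus Lminus hPP D hX 𝔭 h𝔭 hp𝔭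
  haveI : ContinuousSMul ℤ_[2] (W.tateModule 2) := TateModule.continuousSMul_padicInt
  haveI : Module.Free ℤ_[2] (W.tateModule 2) := module_free_tateModule_holds W 2
  haveI : Module.Finite ℤ_[2] (W.tateModule 2) := module_finite_tateModule_holds W 2
  -- the place of `ℚ` above `2`
  have hv : ((2 : ℕ) : 𝓞 ℚ) ∈
      ((Rat.HeightOneSpectrum.primesEquiv (R := 𝓞 ℚ)).symm ⟨2, Nat.prime_two⟩).asIdeal :=
    (natCast_mem_asIdeal_iff_eq_primesEquiv_symm _ Nat.prime_two).mpr rfl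
  -- the involution as a ring automorphism, and the twisted prime `𝔮 = ι𝔭`
  let ιe : IwasawaAlgebra 2 ≃+* IwasawaAlgebra 2 := (IwasawaAlgebra.involEquiv 2 : IwasawaAlgebra 2 ≃+* IwasawaAlgebra 2)
  set 𝔮 : PrimeSpectrum (IwasawaAlgebra 2) := PrimeSpectrum.comap (IwasawaAlgebra.invol 2).toRingHom 𝔭 with h𝔮def
  have h𝔮𝔭 : 𝔮.asIdeal = 𝔭.asIdeal.comap ιe := IwasawaInvolution.ideal_comap_invol_toRingHom 2 𝔭.asIdeal
  have h𝔮 : 𝔮.asIdeal.height = 1 := by rw [h𝔮def, IwasawaInvolution.height_comap_invol, h𝔭]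
  have hp𝔮 : PowerSeries.C (2 : ℤ_[2]) ∉ 𝔮.asIdeal := fun h ↦
    hp𝔭 ((IwasawaInvolution.C_mem_comap_invol_iff 2 (2 : ℤ_[2]) 𝔭).mp h)
  -- the ι-repaired package AT `𝔮`
  obtain ⟨I, P, _, _, ιP, col, j, s, m, hj, hι, hcj, hloc, hES, hdiv⟩ :=
    hR _ hv W hcm hr hss ha κ γ hκ hγ hcv f hf ϖ hϖ Lplus Lminus hPP D hX 𝔮 h𝔮 hp𝔮
  have hL : kobayashiL 1 Lplus Lminus ≠ 0 := by rw [kobayashiL, if_pos rfl]; exact hPP.2.1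
  have hcs : ιP (col s) ≠ 0 := ne_zero_of_lengthAt_quotient_span_le hL 𝔮 h𝔮 hdiv
  have hs0 : s ≠ 0 := by
    rintro rfl
    exact hcs (by rw [map_zero, map_zero])
  -- (RK) on this habitat datum: `rank_Λ 𝐇¹ ≤ 1` — the socket replacing GZK
  have hrk : Module.rank (IwasawaAlgebra 2) I.H ≤ 1 := hRK W hcm hr hss ha κ γ hκ hγ I
  have hinj := injective_col_of_rank_le_one hγ I hrk ιP col hcs
  have hfin := lengthAt_quotient_span_ne_top_of_rank_le_one hκ hγ I hrk hs0 𝔮 (le_of_eq h𝔮)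
  -- the canonical fine dual and the kernel-built restriction `k : X⁺ ↠ X₀`
  let Y : W.FineSelmerDualData κ γ := W.fineSelmerDualData κ hγ
  obtain ⟨k, -, -, hkker, -⟩ := FineRestriction.exists_fineRestrict_package W κ hγ D Y
  -- (K2^ι) at `𝔭`: `ℓ_𝔭(X₀) ≤ ℓ_𝔮(𝐇¹/Λs)`
  have hK := hK2 W hcm κ γ hκ hγ I Y s ((Kato2004.isEulerSystemClassTwo_iff W hκ I s).mp hES) hs0 𝔭 h𝔭 hp𝔭
  have hu𝔮 : (PowerSeries.C (2 : ℤ_[2]) : IwasawaAlgebra 2) ^ (m + 1) ∉ 𝔮.asIdeal :=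
    pow_not_mem_of_not_mem 𝔮 hp𝔮 (m + 1)
  have hu𝔭 : (PowerSeries.C (2 : ℤ_[2]) : IwasawaAlgebra 2) ^ (m + 1) ∉ 𝔭.asIdeal :=
    pow_not_mem_of_not_mem 𝔭 hp𝔭 (m + 1)
  -- cover of `ker k` with exponent `m + 1`: fine sandwich + (LocCover) at the prime of `ℚ_∞` above `2`, at `2 • x`
  have hjk : ∀ x : D.X, k x = 0 →
      ∃ y : P, j y = (PowerSeries.C (2 : ℤ_[2]) : IwasawaAlgebra 2) ^ (m + 1) • x := by
    intro x hxk
    rw [C_two_pow_succ_smul]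
    refine FineStrictRat.localCover_of_localCover_resOfLe_rat W κ 1 hκ _ hv D (2 • x) (hloc (2 • x))
      fun t ht ↦ ?_
    exact FineSandwich.toDual_two_nsmul_apply_eq_zero W κ 1 D x ((hkker x).1 hxk) t ht
  -- the semilinear four-term inequality with `σ = ι`, `R`-side prime `𝔮`, `S`-side prime `𝔭`
  have h4 := fourTerm_lengthAt_le_upTo_semilinear ιe h𝔮𝔭 ιP col j (fun g y ↦ hj g y) k hu𝔮 hu𝔭
    (fun y hy ↦ C_two_pow_succ_smul_eq_zero (hι y hy))
    (fun x hx ↦ by rw [hinj (hx.trans (map_zero col).symm), smul_zero])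
    (fun x ↦ C_two_pow_succ_smul_eq_zero (hcj x)) hjk s
  -- the zeta bound at `𝔮`, the functional equation, and cancellation of the finite `ℓ_𝔮(𝐇¹/Λs)`
  have hFE := IwasawaInvolution.lengthAt_quotient_kobayashiL_comap_invol_eq hf hss ha hPP 𝔭
  have h : lengthAt (IwasawaAlgebra 2) D.X 𝔭 +
        lengthAt (IwasawaAlgebra 2) (I.H ⧸ Submodule.span (IwasawaAlgebra 2) {s}) 𝔮 ≤
      lengthAt (IwasawaAlgebra 2) (IwasawaAlgebra 2 ⧸ Ideal.span {kobayashiL 1 Lplus Lminus}) 𝔭 +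
        lengthAt (IwasawaAlgebra 2) (I.H ⧸ Submodule.span (IwasawaAlgebra 2) {s}) 𝔮 :=
    h4.trans ((add_le_add hK (hdiv.trans (le_of_eq hFE))).trans (le_of_eq (add_comm _ _)))
  exact (WithTop.add_le_add_iff_right hfin).mp h

end Chain

end SignedKatoOffTwo

end Summit.BirchSwinnertonDyer.BirchSwinnertonDyer.Theorems

end
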